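import Mathlib
import HarnessLib
import Summits.NavierStokesRegularity.NavierStokesRegularity.Theorems.UnthreadedRigidityDoorUnthreadedRigiditySpectralEdgeHalfLaplacianInjective
import Literature.Analysis.Calculus.SphereSpectralShell
import Literature.Analysis.Calculus.AngularMomentumFields

/-!
# Route `UnthreadedRigidityDoor`, wall item W2 `UnthreadedRigidity` (stmt-NavierStokesRegularity-27585) — LINE g13-2 «EDGE COERCIVITY»
# (ns-idea-6 g13, `EdgeCoercive_sketch.lean` v1.4 §1b (iv)): GREEN'S DIFFERENCE IDENTITY ON THE UNIT SPHERE for homogeneous functions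

Seat ns-es-p1 g9.  Tools for `EdgeSharpCoercivity l` (`…SpectralEdgeSharpCoercivity`):
* `sphLaplacian_homogeneous` — for `F` of class `C²`, homogeneous of integer degree `a`: the spherical Laplacian (Literature
  `Literature.Analysis.Calculus.sphLaplacian`, standard basis) is `T F(x) = |x|²Δ₃F(x) − a(a+1)F(x)` (Literature `sum_sum_fderiv_fderiv_angularField`
  + Euler's relation twice);
* ★ `sphereIntegral_green_homogeneous` — for smooth `F`, `G` homogeneous of degrees `a`, `b`:
  `∫_{S²} (F·Δ₃G − G·Δ₃F) dσ = (b(b+1) − a(a+1)) ∫_{S²} F G dσ` (symmetry of `T`, Literature `sphDirichlet_eq_neg_sphereIntegral`);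
* ★ `sphereIntegral_harmonic_orthogonal` — harmonic homogeneous functions of different nonnegative degrees are `L²(S²)`-orthogonal.

HONEST LABEL: calculus helpers for a quantitative support of a files-only RUNG line two levels below W2; nothing here bears on `UnthreadedRigidity`
(27585), W2 or NS regularity.  0 kit.  [folklore; spherical harmonics (Laplace 1782, Legendre)]
-/

noncomputable section

-- the summit and its single sub-problem share the name (CONVENTIONS §1), as in every Theorems file
set_option linter.dupNamespace false

namespace Summit.NavierStokesRegularity.NavierStokesRegularity.Theorems.UnthreadedRigidity.SpectralEdge

open Set Function Filter Topology MeasureTheory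
open scoped RealInnerProductSpace ContDiff
open Literature.Analysis.FluidPDE (sphereIntegral fderiv_homogeneous fderiv_apply_self_of_homogeneous)
open Literature.Analysis.Calculus (angularField angDeriv sphLaplacian sphDirichlet sum_sum_fderiv_fderiv_angularField
  sphDirichlet_eq_neg_sphereIntegral sphDirichlet_comm sphereIntegral_congr_norm sphereIntegral_sub' sphereIntegral_add_of
  sphereIntegral_mul_left sphereIntegral_nonneg')
open Summit.NavierStokesRegularity.NavierStokesRegularity.Theorems.UnthreadedRigidity.ProfileHorn (E3)
open Summit.NavierStokesRegularity.NavierStokesRegularity.Theorems.UnthreadedRigidity.VirialHorn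

variable {F G : E3 → ℝ}

/-! ## §1 The spherical Laplacian of a homogeneous function -/

/-- `dir2 f v x = D²f(x)(v, v)` for a `C²` function. [folklore] -/
theorem dir2_eq_fderiv_fderiv (hF : ContDiff ℝ 2 F) (v x : E3) : dir2 F v x = fderiv ℝ (fderiv ℝ F) x v v := by
  have hd : DifferentiableAt ℝ (fderiv ℝ F) x := ((hF.fderiv_right (m := 1) le_rfl).differentiable one_ne_zero) x
  unfold dir2
  rw [fderiv_clm_apply hd (differentiableAt_const v)]
  simp only [fderiv_fun_const, Pi.zero_apply, ContinuousLinearMap.comp_zero, zero_add, ContinuousLinearMap.flip_apply]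

/-- ★ for `F ∈ C²` homogeneous of integer degree `a`: `T F(x) = |x|² Δ₃F(x) − a(a+1) F(x)` (standard basis). [folklore] -/
theorem sphLaplacian_homogeneous (hF : ContDiff ℝ 2 F) (a : ℤ) (hhom : ∀ c : ℝ, 0 < c → ∀ z : E3, F (c • z) = c ^ a • F z) (x : E3) :
    sphLaplacian (EuclideanSpace.basisFun (Fin 3) ℝ) F x = ‖x‖ ^ 2 * lap3 F x - (a : ℝ) * ((a : ℝ) + 1) * F x := by
  have hd : DifferentiableAt ℝ (fderiv ℝ F) x := ((hF.fderiv_right (m := 1) le_rfl).differentiable one_ne_zero) x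
  -- Euler, once and twice
  have hE1 : fderiv ℝ F x x = (a : ℝ) * F x := by
    rw [fderiv_apply_self_of_homogeneous F a hhom ((hF.differentiable (by norm_num)) x), smul_eq_mul]
  have hhom' : ∀ c : ℝ, 0 < c → ∀ z : E3, fderiv ℝ F (c • z) = c ^ (a - 1) • fderiv ℝ F z :=
    fun c hc z => fderiv_homogeneous F a hhom c hc z
  have hE2 : fderiv ℝ (fderiv ℝ F) x x x = (a : ℝ) * ((a : ℝ) - 1) * F x := by
    have h := fderiv_apply_self_of_homogeneous (fderiv ℝ F) (a - 1) hhom' hd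
    rw [h, FunLike.coe_smul, Pi.smul_apply, smul_eq_mul, hE1]
    push_cast
    ring
  unfold sphLaplacian angDeriv
  rw [sum_sum_fderiv_fderiv_angularField (EuclideanSpace.basisFun (Fin 3) ℝ) hd]
  have hlap : lap3 F x = ∑ k : Fin 3, fderiv ℝ (fderiv ℝ F) x ((EuclideanSpace.basisFun (Fin 3) ℝ) k) ((EuclideanSpace.basisFun (Fin 3) ℝ) k) := by
    unfold lap3
    refine Finset.sum_congr rfl fun k _ => ?_
    rw [dir2_eq_fderiv_fderiv hF, EuclideanSpace.basisFun_apply]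
    rfl
  rw [hlap, hE2, hE1, Fintype.card_fin]
  push_cast
  ring

/-! ## §2 Green's difference identity and orthogonality on the unit sphere -/

/-- ★ GREEN'S DIFFERENCE IDENTITY ON `S²`: for smooth `F`, `G` homogeneous of integer degrees `a`, `b`,
`∫_{S²} (F·Δ₃G − G·Δ₃F) dσ = (b(b+1) − a(a+1)) ∫_{S²} F G dσ`. [folklore] -/
theorem sphereIntegral_green_homogeneous (hF : ContDiff ℝ ∞ F) (hG : ContDiff ℝ ∞ G) (a b : ℤ)
    (hFh : ∀ c : ℝ, 0 < c → ∀ z : E3, F (c • z) = c ^ a • F z) (hGh : ∀ c : ℝ, 0 < c → ∀ z : E3, G (c • z) = c ^ b • G z) :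
    sphereIntegral (volume : Measure E3) (fun x => F x * lap3 G x - G x * lap3 F x) 1 =
      (((b : ℝ) * ((b : ℝ) + 1)) - (a : ℝ) * ((a : ℝ) + 1)) * sphereIntegral (volume : Measure E3) (fun x => F x * G x) 1 := by
  set bb := EuclideanSpace.basisFun (Fin 3) ℝ with hbb
  have hF2 : ContDiff ℝ 2 F := hF.of_le (by norm_cast)
  have hG2 : ContDiff ℝ 2 G := hG.of_le (by norm_cast)
  -- symmetry of `T`: `∫ F·TG = ∫ G·TF`
  have hsym : sphereIntegral (volume : Measure E3) (fun x => F x * sphLaplacian bb G x) 1 =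
      sphereIntegral (volume : Measure E3) (fun x => G x * sphLaplacian bb F x) 1 := by
    have h1 := sphDirichlet_eq_neg_sphereIntegral bb (f := F) (g := G) ((hF.of_le (by norm_cast)).contDiffOn) (hG2.contDiffOn) one_pos
    have h2 := sphDirichlet_eq_neg_sphereIntegral bb (f := G) (g := F) ((hG.of_le (by norm_cast)).contDiffOn) (hF2.contDiffOn) one_pos
    rw [sphDirichlet_comm] at h2
    linarith
  -- on the unit sphere `T = Δ₃ − deg(deg+1)`
  have hTG : sphereIntegral (volume : Measure E3) (fun x => F x * sphLaplacian bb G x) 1 =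
      sphereIntegral (volume : Measure E3) (fun x => F x * lap3 G x - ((b : ℝ) * ((b : ℝ) + 1)) * (F x * G x)) 1 := by
    refine sphereIntegral_congr_norm zero_le_one fun x hx => ?_
    rw [hbb, sphLaplacian_homogeneous hG2 b hGh x, hx]
    ring
  have hTF : sphereIntegral (volume : Measure E3) (fun x => G x * sphLaplacian bb F x) 1 =
      sphereIntegral (volume : Measure E3) (fun x => G x * lap3 F x - ((a : ℝ) * ((a : ℝ) + 1)) * (F x * G x)) 1 := by
    refine sphereIntegral_congr_norm zero_le_one fun x hx => ?_
    rw [hbb, sphLaplacian_homogeneous hF2 a hFh x, hx]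
    ring
  -- continuity of the integrands
  have cF : Continuous F := hF.continuous
  have cG : Continuous G := hG.continuous
  have cLF : Continuous (lap3 F) := (contDiff_lap3 hF).continuous
  have cLG : Continuous (lap3 G) := (contDiff_lap3 hG).continuous
  have c1 : ContinuousOn (fun x => F x * lap3 G x) {0}ᶜ := (cF.mul cLG).continuousOn
  have c2 : ContinuousOn (fun x => G x * lap3 F x) {0}ᶜ := (cG.mul cLF).continuousOn
  have c3 : ContinuousOn (fun x => ((b : ℝ) * ((b : ℝ) + 1)) * (F x * G x)) {0}ᶜ := (continuous_const.mul (cF.mul cG)).continuousOn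
  have c4 : ContinuousOn (fun x => ((a : ℝ) * ((a : ℝ) + 1)) * (F x * G x)) {0}ᶜ := (continuous_const.mul (cF.mul cG)).continuousOn
  rw [hTG, hTF, sphereIntegral_sub' c1 c3 one_pos, sphereIntegral_sub' c2 c4 one_pos, sphereIntegral_mul_left, sphereIntegral_mul_left] at hsym
  rw [sphereIntegral_sub' c1 c2 one_pos]
  linarith

/-- ★ ORTHOGONALITY: smooth harmonic functions, homogeneous of integer degrees `a ≠ b` with `0 ≤ a`, `0 ≤ b`, are orthogonal in `L²(S²)`. [folklore] -/
theorem sphereIntegral_harmonic_orthogonal (hF : ContDiff ℝ ∞ F) (hG : ContDiff ℝ ∞ G) (a b : ℤ) (ha : 0 ≤ a) (hb : 0 ≤ b) (hab : a ≠ b)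
    (hFh : ∀ c : ℝ, 0 < c → ∀ z : E3, F (c • z) = c ^ a • F z) (hGh : ∀ c : ℝ, 0 < c → ∀ z : E3, G (c • z) = c ^ b • G z)
    (hFl : ∀ x : E3, lap3 F x = 0) (hGl : ∀ x : E3, lap3 G x = 0) :
    sphereIntegral (volume : Measure E3) (fun x => F x * G x) 1 = 0 := by
  have h := sphereIntegral_green_homogeneous hF hG a b hFh hGh
  have h0 : sphereIntegral (volume : Measure E3) (fun x => F x * lap3 G x - G x * lap3 F x) 1 = 0 := by
    rw [sphereIntegral_congr_norm zero_le_one (g := fun _ => (0 : ℝ)) (fun x _ => by rw [hFl x, hGl x]; ring)]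
    simp [Literature.Analysis.FluidPDE.sphereIntegral_def]
  rw [h0] at h
  have hne : ((b : ℝ) * ((b : ℝ) + 1)) - (a : ℝ) * ((a : ℝ) + 1) ≠ 0 := by
    have : ((b : ℝ) * ((b : ℝ) + 1)) - (a : ℝ) * ((a : ℝ) + 1) = ((b : ℝ) - a) * ((b : ℝ) + a + 1) := by ring
    rw [this]
    refine mul_ne_zero ?_ ?_
    · have : (a : ℝ) ≠ (b : ℝ) := by exact_mod_cast hab
      intro h'; apply this; linarith
    · have : (0 : ℝ) ≤ (a : ℝ) := by exact_mod_cast ha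
      have : (0 : ℝ) ≤ (b : ℝ) := by exact_mod_cast hb
      intro h'; linarith
  rcases mul_eq_zero.1 h.symm with h' | h'
  · exact absurd h' hne
  · exact h'

end Summit.NavierStokesRegularity.NavierStokesRegularity.Theorems.UnthreadedRigidity.SpectralEdge

end
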